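import Summits.QuantumAdvantage.QuantumAdvantage.Theorems.LocusDialDeclarable
import Summits.QuantumAdvantage.QuantumAdvantage.Theorems.LocusDialFreePointerAE

/-!
# LocusDialDeclarablePointer — the pointer edge `MFreeAnchorLoss3 → FreePointerLossAE3 → FreePointerLoss3`

Cell decomp-qadv, seat lens-2, generation 17 — tree part (supports item stmt-QuantumAdvantage-27137; companion of
`LocusDialDeclarable` and `LocusDialFreePointerAE`).  The a.e.-declared free pointer is the `(m, r) = (1, 0)` instance of the
unstable-anchor law: the anchors of `mpStrat A 1` are `A` itself.  Lattice by name after landing: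
`T → MFreeAnchorLoss3 → {FewLocusLossOne3, FreePointerLossAE3 → FreePointerLoss3 → AdaptiveAffinePointerLoss3 → AffinePointerLoss3}`.
No `sorry`; standard axioms.
-/

set_option linter.dupNamespace false

noncomputable section

open scoped Classical

namespace Summit.QuantumAdvantage.QuantumAdvantage.Theorems.LocusDial

/-! ## §R4  The pointer edge: the unstable-anchor law gives the a.e. free pointer -/

section PointerEdge

open Finset
open Literature.Computability.QuantumComplexity Literature.Computability.QuantumComplexity.RingHLF
open Literature.Computability.MetaComplexity Literature.Computability.MetaComplexity.Smolensky
open Summit.QuantumAdvantage.AdviceFreeQNC0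
open Summit.QuantumAdvantage.QuantumAdvantage.Theorems.HolonomyDial (gCond)
open Summit.QuantumAdvantage.QuantumAdvantage.Theorems.AnchorDial (outB dev mpStrat mpStrat_mem deg_bump4)

/-- **`MFreeAnchorLoss3 → FreePointerLossAE3`**: the a.e.-declared free pointer is the `(m, r) = (1, 0)` instance of the
unstable-anchor law — the anchors of `mpStrat A 1` are `A` itself (no stability needed or available). -/
theorem freePointerLossAE3_of_mFreeAnchorLoss3 (h : MFreeAnchorLoss3) : FreePointerLossAE3 := by
  obtain ⟨C, hC⟩ := h
  refine ⟨C, fun c => ?_⟩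
  obtain ⟨n₀, hn₀⟩ := hC 1 0 (c + 1)
  refine ⟨max n₀ 64, fun n hn A hA hae => ?_⟩
  have hn64 : 64 ≤ n := le_of_max_le_right hn
  have hlog : 1 ≤ Nat.log 2 n := Nat.le_log_of_pow_le (by norm_num) (by omega)
  have hQ : ∀ i, mpStrat A (fun _ => 1) i ∈ lowDeg (ZMod 3) n ((Nat.log 2 n) ^ (c + 1)) := fun i =>
    lowDeg_mono (deg_bump4 n c hn64) (mpStrat_mem hA (fun _ => one_mem_lowDeg _) i)
  have hfree : MFreeAnchorable 1 0 (c + 1) (mpStrat A (fun _ => 1)) := by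
    refine ⟨fun _ => A, fun _ k => lowDeg_mono (Nat.pow_le_pow_right hlog (by omega)) (hA k), fun _ => hae, ?_⟩
    have hsub : (univ.filter fun x : Fin n → Bool => OddZeros x ∧
        ¬ ∃ kv : Fin 1 → Fin n, (∀ j, (fun _ : Fin 1 => A) j (kv j) x = 1) ∧
          ∀ i ∈ dev (mpStrat A (fun _ => 1)) x, ∃ j, (kv j).val ≤ i.val ∧ i.val ≤ (kv j).val + 0) ⊆
        univ.filter fun x : Fin n → Bool => OddZeros x ∧ (univ.filter fun k : Fin n => A k x = 1).card ≠ 1 := by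
      intro x hx
      rw [mem_filter] at hx ⊢
      refine ⟨mem_univ _, hx.2.1, fun h1 => hx.2.2 ?_⟩
      obtain ⟨k₀, hk₀⟩ := card_eq_one.1 h1
      have hmem : A k₀ x = 1 := by
        have : k₀ ∈ (univ.filter fun k : Fin n => A k x = 1) := by rw [hk₀]; exact mem_singleton_self _
        exact (mem_filter.1 this).2
      refine ⟨fun _ => k₀, fun _ => hmem, fun i hi => ⟨0, ?_⟩⟩
      rw [dev_mpStrat_one (by omega) A x k₀ hk₀, mem_singleton] at hi
      subst hi
      exact ⟨le_rfl, le_rfl⟩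
    calc Nat.log 2 n * (univ.filter fun x : Fin n → Bool => OddZeros x ∧
          ¬ ∃ kv : Fin 1 → Fin n, (∀ j, (fun _ : Fin 1 => A) j (kv j) x = 1) ∧
            ∀ i ∈ dev (mpStrat A (fun _ => 1)) x, ∃ j, (kv j).val ≤ i.val ∧ i.val ≤ (kv j).val + 0).card
        ≤ Nat.log 2 n * (univ.filter fun x : Fin n → Bool =>
            OddZeros x ∧ (univ.filter fun k : Fin n => A k x = 1).card ≠ 1).card :=
          Nat.mul_le_mul_left _ (card_le_card hsub)
      _ ≤ 2 ^ (n - 1) := hae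
      _ ≤ 2 ^ n := Nat.pow_le_pow_right (by norm_num) (Nat.sub_le n 1)
  have hle := hn₀ n (le_of_max_le_left hn) _ hQ hfree
  refine le_trans ?_ hle
  have hsub : (univ.filter fun x : Fin n → Bool => OddZeros x ∧
        (univ.filter fun k : Fin n => A k x = 1).card = 1 ∧ ∃ k : Fin n, A k x = 1 ∧ gCond x k.val) ⊆
      univ.filter fun x : Fin n → Bool =>
        OddZeros x ∧ Rel x (fun i => decide (mpStrat A (fun _ => 1) i x = 1)) := by
    intro x hx
    rw [mem_filter] at hx ⊢
    obtain ⟨-, hodd, h1, k, hk, hg⟩ := hx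
    exact ⟨mem_univ _, hodd,
      (rel_mpStrat_one (by omega) A x hodd k (filter_eq_singleton_of_card h1 hk)).2 hg⟩
  exact_mod_cast card_le_card hsub

/-- so, by name: `U → MFreeAnchorLoss3`?  NO — only `T → MFreeAnchorLoss3` and `MFreeAnchorLoss3 → FewLocusLossOne3`,
`MFreeAnchorLoss3 → FreePointerLossAE3 → FreePointerLoss3 → AffinePointerLoss3`; the general-`m` declarability
(`FewLocus m r → MFreeAnchorable m r (c+2)`, greedy recursion) would give `MFreeAnchorLoss3 → FewLocusLoss3 = U`. -/
theorem freePointerLoss3_of_mFreeAnchorLoss3 (h : MFreeAnchorLoss3) : FreePointerLoss3 :=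
  freePointerLoss3_of_ae (freePointerLossAE3_of_mFreeAnchorLoss3 h)

end PointerEdge

end Summit.QuantumAdvantage.QuantumAdvantage.Theorems.LocusDial
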